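import Summits.CriticalPhenomena.PercolationContinuityZ3.Theorems.PercNearOneGluingNoHeavyLowerTailSunflowerMultiPetalKempeMarkedTIStepOne
import Summits.CriticalPhenomena.PercolationContinuityZ3.Theorems.PercNearOneGluingNoHeavyLowerTailSunflowerMultiPetalKempeMarkedTIHeart
import Summits.CriticalPhenomena.PercolationContinuityZ3.Theorems.PercNearOneGluingNoHeavyLowerTailSunflowerMultiPetalKempeMarkedTIIsolated
import HarnessLib
import HarnessLib.Audit

/-!
# `NoHeavyLowerTail` (crux stmt-CriticalPhenomena-4575), marked multigraphs: **THEOREM TI2, KERNEL-CHECKED** —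
# `T(K/su; u,v) ≤ T(K; u,v) + T(K + us; u,v)` for every marked multigraph, terminals `u ≠ v`, vertex `s ∉ {u,v}`

Support file (seat `prim-l12-p2` gen 52; `--supports stmt-CriticalPhenomena-4575`; assembles `…KempeMarkedTIDefs` (p635933), `…TIIsolated` (p636678), `…TICells`
(p636747), `…TIPayers` (p637060), `…TIHeart` (p637684), `…TIRows` (p637946), `…TIRowsNear`, `…TIStepOne`).  No `sorry`; nothing is asserted about the crux.
Memo: run/shared/lean/prim/prim-l12/prim-l12-p2/FINDING-g51-TI-HIERARCHY.md §9; PROOF-TI2-MARKED-MULTIGRAPHS-g51.md.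

THE INDUCTION on the number of active vertices, for both weight colours `c ∈ {0,1}` at once (`TI₀(K;s,u,v) = TI₁(K;s,v,u)` moves every `v`-side case to the
`u`-side of the other colour):
(a) a marked non-terminal `y ≠ s` is deleted monotonically (`TIfun_isolate_le_of_mark`); (b) a marked terminal: `TIfun_nonneg_of_mark` (first terminal) or the
same after the swap; (e) an unmarked `y ∉ {u,v,s}` joined to `u` (or to `v`, after the swap): outer degree `0` — the exact identity `three_mul_TIfun_eq_of_pendant`;
outer degree `1` — the step inequalities of `…TIStepOne`; outer degree `≥ 2` — the weighted heart `sum_resW_nonneg` with the cell identity `sum_resW_eq`; in each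
case the subtracted functionals live on graphs with fewer active vertices (or are plain `T`'s, nonnegative by p609343); (c)+(f) otherwise no vertex but `s`
touches the unmarked terminals: `TIfun_nonneg_of_terminalIsolated` (after the swap for `c = 1`).
RESULTS: **`TIfun_nonneg`** (`0 ≤ TI_c(K; s,u,v)`), **`TfunM_contractOne_le`** (THEOREM TI2: `T(K/su) ≤ 3·(T(K) + T(K+us))` on `V`, `s` free on the left —
i.e. `T(K/su) ≤ T(K) + T(K+us)`), `two_mul_TfunM_contractOne_le` (`2·T(K/su) ≤ 6·T(K) + T((K/su)⁺ᵘ)`: identification into a terminal at most doubles `T`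
up to half the marked term).
-/

namespace Summit.CriticalPhenomena.PercolationContinuityZ3.Theorems.SunflowerPartition.Kempe

open Finset

namespace MGraph

variable {V : Type*} [Fintype V] [LinearOrder V] (K : MGraph V)

section Induction

omit [Fintype V] in
/-- Adding zero marks changes nothing. [this work] -/
theorem addMark_zero (w : V) : K.addMark w 0 = K := by
  refine ext' (fun a b => ?_) (fun a => ?_)
  · unfold addMark addAtU; simp
  · unfold addMark addAtU; simp

/-- Adding marks at an active vertex does not increase the number of active vertices of `K.isolate y` beyond `|active K| − 1` (`w ≠ y` active in `K`). [this work] -/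
theorem card_active_isolate_addMark_lt {y w : V} (hy : y ∈ K.active) (hw : w ∈ K.active) (hwy : w ≠ y) (m : ℕ) :
    ((K.isolate y).addMark w m).active.card < K.active.card := by
  refine lt_of_le_of_lt (card_le_card ?_) (card_erase_lt_of_mem hy)
  refine (active_addMark_subset _ w m).trans (insert_subset (mem_erase.2 ⟨hwy, hw⟩) (K.active_isolate_subset y))

/-- **THE KEY STEP** (case (e) of the memo, `u`-side): if `TI ≥ 0` holds for both weight colours on all marked multigraphs with fewer active vertices, then
`TI_c(K; s,u,v) ≥ 0` whenever some unmarked `y ∉ {u,v,s}` is joined to `u`. [this work] -/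
theorem TIfun_nonneg_of_adj (n : ℕ)
    (ih : ∀ K' : MGraph V, K'.active.card < n → ∀ c : Fin 3, (c = 0 ∨ c = 1) → ∀ s u v : V, u ≠ v → s ≠ u → s ≠ v → 0 ≤ K'.TIfun c s u v)
    (hK : K.active.card ≤ n) (c : Fin 3) (hc : c = 0 ∨ c = 1) (s u v y : V) (huv : u ≠ v) (hsu : s ≠ u) (hsv : s ≠ v)
    (hyu : y ≠ u) (hyv : y ≠ v) (hys : y ≠ s) (hmy : K.mark y = 0) (hadj : K.mul y u ≠ 0) : 0 ≤ K.TIfun c s u v := by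
  set S := univ.filter (fun w : V => w ≠ u ∧ w ≠ v ∧ w ≠ y ∧ K.mul y w ≠ 0) with hSdef
  have hS : ∀ w, w ∈ S ↔ (w ≠ u ∧ w ≠ v ∧ w ≠ y ∧ K.mul y w ≠ 0) := fun w => by rw [hSdef, mem_filter]; simp
  have hyact : y ∈ K.active := K.mem_active_of_mul_ne_zero hadj
  have huact : u ∈ K.active := K.mem_active_of_mul_ne_zero' hadj
  have huS : u ∉ S := fun h => ((hS u).1 h).1 rfl
  have hvS : v ∉ S := fun h => ((hS v).1 h).2.1 rfl
  have hyS : y ∉ S := fun h => ((hS y).1 h).2.2.1 rfl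
  have h0 : 0 ≤ (K.isolate y).TIfun c s u v := ih _ (lt_of_lt_of_le (K.card_active_isolate_lt hyact) hK) c hc s u v huv hsu hsv
  have hPC : (K.peelContract y S u).active.card < n :=
    lt_of_lt_of_le (lt_of_le_of_lt (card_le_card (K.active_peelContract_subset y u S huact)) (card_erase_lt_of_mem hyact)) hK
  -- the weighted all-0 sum is nonnegative (contraction bookkeeping)
  have hAZW : 0 ≤ K.AZW c y S s u v := by
    have h3 : (0 : ℤ) < 3 ^ S.card := by positivity
    by_cases hsS : s ∈ S
    · rcases hc with h | h
      · subst h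
        have e := K.pow_mul_AZW_eq_of_mem_zero y u v s S hyu.symm huS hyS hvS hsS
        have := ((K.addMark u 1).peelContract y S u).TfunM_nonneg u v
        rw [← e] at this
        exact (mul_nonneg_iff_of_pos_left h3).1 this
      · subst h
        have e := K.pow_mul_AZW_eq_of_mem_one y u v s S hyu.symm huS hyS hvS hsS
        have := (K.peelContract y S u).TfunM_nonneg u v
        have h2 : 0 ≤ 3 ^ S.card * K.AZW 1 y S s u v := by rw [e]; linarith
        exact (mul_nonneg_iff_of_pos_left h3).1 h2
    · have e := K.pow_mul_AZW_eq_TIfun c y u v s S hyu.symm huS hyS hvS hsS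
      have := ih _ hPC c hc s u v huv hsu hsv
      rw [← e] at this
      exact (mul_nonneg_iff_of_pos_left h3).1 this
  rcases Nat.lt_or_ge S.card 2 with hlt | hge
  · rcases Nat.lt_or_ge S.card 1 with h0' | h1'
    · -- outer degree 0: exact identity
      have hS0 : S = ∅ := card_eq_zero.1 (by omega)
      have hnone : ∀ w, w ≠ u → w ≠ v → K.mul y w = 0 := by
        intro w hwu hwv
        by_cases hwy : w = y
        · rw [hwy]; exact K.loopless y
        by_contra hne
        have : w ∈ S := (hS w).2 ⟨hwu, hwv, hwy, hne⟩
        rw [hS0] at this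
        exact notMem_empty w this
      have hid := K.three_mul_TIfun_eq_of_pendant c y s u v huv hys hyu hyv hmy hnone
      have hA : 0 ≤ ((K.isolate y).addMark u (K.mul y u)).TIfun c s u v :=
        ih _ (lt_of_lt_of_le (K.card_active_isolate_addMark_lt hyact huact hyu.symm _) hK) c hc s u v huv hsu hsv
      have hB : 0 ≤ ((K.isolate y).addMark v (K.mul y v)).TIfun c s u v := by
        by_cases hv0 : K.mul y v = 0
        · rw [hv0, addMark_zero]; exact h0
        · have hvact : v ∈ K.active := K.mem_active_of_mul_ne_zero' hv0
          exact ih _ (lt_of_lt_of_le (K.card_active_isolate_addMark_lt hyact hvact hyv.symm _) hK) c hc s u v huv hsu hsv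
      linarith
    · -- outer degree 1
      have hone : S.card = 1 := by omega
      obtain ⟨s', hS'⟩ := card_eq_one.1 hone
      rw [hS'] at hS hAZW
      have hcell := K.sum_resW_eq (c := c) (S := {s'}) hc hys hyu hyv
      by_cases hss' : s = s'
      · subst hss'
        have h := sum_resW_nonneg_near hc hS huv hyu hyv hmy hadj
        rw [hcell] at h
        linarith
      · rcases hc with h | h
        · subst h
          by_cases hv0 : K.mul y v = 0
          · have h := sum_resWL_nonneg_far_zero_zero hS huv hyu hyv hmy hadj hv0 hss' hsu
            rw [sum_resWL_eq {s'} hys hyu hyv] at h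
            linarith
          · have h := sum_resW_nonneg_far_zero_pos hS huv hyu hyv hmy hadj hv0 hss' hsu
            rw [hcell] at h
            linarith
        · subst h
          have h := sum_resW_nonneg_far_one hS huv hyu hyv hmy hadj hss' hsu
          rw [hcell] at h
          linarith
  · -- outer degree ≥ 2: the weighted heart
    have h := sum_resW_nonneg c hc hS huv hyu hyv hsu hmy hadj hge
    rw [K.sum_resW_eq (c := c) (S := S) hc hys hyu hyv] at h
    linarith

/-- **INDUCTION STEP**: `TI ≥ 0` for all marked multigraphs with fewer active vertices implies it for `K` (both weight colours). [this work] -/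
theorem TIfun_nonneg_step (n : ℕ)
    (ih : ∀ K' : MGraph V, K'.active.card < n → ∀ c : Fin 3, (c = 0 ∨ c = 1) → ∀ s u v : V, u ≠ v → s ≠ u → s ≠ v → 0 ≤ K'.TIfun c s u v)
    (hK : K.active.card ≤ n) (c : Fin 3) (hc : c = 0 ∨ c = 1) (s u v : V) (huv : u ≠ v) (hsu : s ≠ u) (hsv : s ≠ v) :
    0 ≤ K.TIfun c s u v := by
  -- (a) a marked non-terminal other than s
  by_cases ha : ∃ y, y ≠ u ∧ y ≠ v ∧ y ≠ s ∧ K.mark y ≠ 0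
  · obtain ⟨y, hyu, hyv, hys, hmy⟩ := ha
    have h1 := K.TIfun_isolate_le_of_mark c y s u v hys hyu hyv hmy
    have h0 := ih _ (lt_of_lt_of_le (K.card_active_isolate_lt (K.mem_active_of_mark_ne_zero hmy)) hK) c hc s u v huv hsu hsv
    linarith
  push Not at ha
  -- the swap: TI_c(K;s,u,v) = TI_{1-c}(K;s,v,u)
  have hswap : ∀ c' : Fin 3, (c' = 0 ∨ c' = 1) → ∀ u' v' : V, ∃ c'' : Fin 3, (c'' = 0 ∨ c'' = 1) ∧ K.TIfun c' s u' v' = K.TIfun c'' s v' u' := by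
    intro c' hc' u' v'
    rcases hc' with h | h
    · exact ⟨1, Or.inr rfl, by rw [h, K.TIfun_swap s u' v']⟩
    · exact ⟨0, Or.inl rfl, by rw [h, ← K.TIfun_swap s v' u']⟩
  -- (b) a marked terminal
  by_cases hmu : K.mark u = 0
  swap
  · exact K.TIfun_nonneg_of_mark c hc s u v huv hsu hmu
  by_cases hmv : K.mark v = 0
  swap
  · obtain ⟨c'', hc'', e⟩ := hswap c hc u v
    rw [e]; exact K.TIfun_nonneg_of_mark c'' hc'' s v u huv.symm hsv hmv
  -- (e) an unmarked y ∉ {u,v,s} joined to a terminal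
  by_cases hb : ∃ y, y ≠ u ∧ y ≠ v ∧ y ≠ s ∧ (K.mul y u ≠ 0 ∨ K.mul y v ≠ 0)
  · obtain ⟨y, hyu, hyv, hys, hadj⟩ := hb
    rcases hadj with h | h
    · exact K.TIfun_nonneg_of_adj n ih hK c hc s u v y huv hsu hsv hyu hyv hys (ha y hyu hyv hys) h
    · obtain ⟨c'', hc'', e⟩ := hswap c hc u v
      rw [e]; exact K.TIfun_nonneg_of_adj n ih hK c'' hc'' s v u y huv.symm hsv hsu hyv hyu hys (ha y hyu hyv hys) h
  push Not at hb
  -- (c)+(f) the terminal-isolated case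
  have hiso : ∀ w, w ≠ u → w ≠ v → w ≠ s → K.mul w u = 0 ∧ K.mul w v = 0 := fun w hwu hwv hws => hb w hwu hwv hws
  rcases hc with h | h
  · subst h; exact TIfun_nonneg_of_terminalIsolated huv hsu hsv hmu hmv hiso
  · subst h
    rw [← K.TIfun_swap s v u]
    exact TIfun_nonneg_of_terminalIsolated huv.symm hsv hsu hmv hmu (fun w hwv hwu hws => (hiso w hwu hwv hws).symm)

/-- **`TI ≥ 0` FOR EVERY MARKED MULTIGRAPH** (both weight colours): 'a vertex coloured like a terminal is half a mark at that terminal' — the first rung of the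
TI hierarchy of the memo, kernel-checked. [this work] -/
theorem TIfun_nonneg (c : Fin 3) (hc : c = 0 ∨ c = 1) (s u v : V) (huv : u ≠ v) (hsu : s ≠ u) (hsv : s ≠ v) : 0 ≤ K.TIfun c s u v := by
  have main : ∀ n : ℕ, ∀ K' : MGraph V, K'.active.card ≤ n → ∀ c : Fin 3, (c = 0 ∨ c = 1) → ∀ s u v : V, u ≠ v → s ≠ u → s ≠ v →
      0 ≤ K'.TIfun c s u v := by
    intro n
    induction n using Nat.strong_induction_on with
    | _ n ihn =>
      intro K' hK' c hc s u v huv hsu hsv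
      exact K'.TIfun_nonneg_step n (fun K'' h => ihn K''.active.card h K'' le_rfl) hK' c hc s u v huv hsu hsv
  exact main _ K le_rfl c hc s u v huv hsu hsv

/-- **THEOREM TI2 (kernel-checked)**: for every marked multigraph `K`, terminals `u ≠ v` and `s ∉ {u,v}`,
`T(K/su; u,v) ≤ 3·(T(K; u,v) + T(K + us; u,v))` — the contraction `K.contractOne s u` realised on `V` keeps `s` as a free vertex (factor `3`), so this is
`T(K/su) ≤ T(K) + T(K+us)`: identifying a vertex into a terminal costs at most the two-terminal functional of the graph with one more edge `us`. [this work] -/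
theorem TfunM_contractOne_le (s u v : V) (huv : u ≠ v) (hsu : s ≠ u) (hsv : s ≠ v) :
    (K.contractOne s u).TfunM u v ≤ 3 * (K.TfunM u v + (K.addAtU u (fun w => if w = s then 1 else 0) (if_neg hsu.symm) 0).TfunM u v) :=
  K.TfunM_contractOne_le_of_TIfun_nonneg s u v hsu hsv (K.TIfun_nonneg 0 (Or.inl rfl) s u v huv hsu hsv)

/-- **TI2, marked form**: `2·T(K/su) ≤ 6·T(K) + T((K/su)⁺ᵘ)` (on `V`, `s` free in the contractions) — identification into the terminal `u` at most doubles
`T`, up to half the once-more-marked term. [this work] -/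
theorem two_mul_TfunM_contractOne_le (s u v : V) (huv : u ≠ v) (hsu : s ≠ u) (hsv : s ≠ v) :
    2 * (K.contractOne s u).TfunM u v ≤ 6 * K.TfunM u v + ((K.contractOne s u).addMark u 1).TfunM u v := by
  have h1 := K.three_mul_TIfun_eq s u v hsu hsv
  have h2 := K.TIfun_nonneg 0 (Or.inl rfl) s u v huv hsu hsv
  linarith

end Induction

end MGraph

end Summit.CriticalPhenomena.PercolationContinuityZ3.Theorems.SunflowerPartition.Kempe
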